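import Summits.Ventures.CertifiedManyBodySolver.Upper.DWaveSourceOpenClusterCut
import Literature.MathematicalPhysics.QuantumLattice.DWaveSourceParticleHole
import HarnessLib

/-!
# Lieb's partial particle–hole transformation of the OPEN sourced box `dWaveSourceOpenBox a b U μ h`

HONEST FRAMING: first certified bounds; not a superconductivity verdict. Nothing here is a number or a row. This is
the OPERATOR half of the FORMAT-mpsgf1 soundness sentence (sr-mbsolver-var-4 co-read, R9 «the frame W is a Fock-space
unitary with W†(H_box)W = H̃ number-conserving»), written by the IRD desk (sr-mbsolver-ird-5) by transporting the
TREE's torus statement `partialParticleHole_conj_dWaveSourceTorus` (`Literature/…/DWaveSourceParticleHole.lean`) to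
pin-1's open box (`Upper/DWaveSourceOpenClusterCut.lean`):

* `sum_dWaveBoxPairWeight_smul_bondPair_eq_bdgPairing`: the box source `P_C = Σ_{(p,q)} w_C(p,q) b_{pq}` IS the
  tree's BdG bond pairing `bdgPairing w_C`;
* `dWaveSourceOpenBox_eq_bdgBondHamiltonian_add`: `A_C(μ,h) = H_BdG(−[p∼q], −h·w_C, μ) + U Σ_p n_{p↑}n_{p↓}`;
* **`partialParticleHole_conj_dWaveSourceOpenBox`**: with `W = partialParticleHole D↓` (Lieb: `c_{p↓} ↦ c†_{p↓}`),
  `W · A_C(μ,h) · Wᴴ = dΓ(𝓗) − μ·ab·1 + U (N_↑ − Σ_p n_{p↑}n_{p↓})`, `𝓗 = bdgNambuMatrix (−[p∼q]) (−h·w_C) μ` — a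
  particle-NUMBER-CONSERVING operator (one-body `dΓ` + density–density): the `U(1)`-breaking pair source has become
  the spin-flip hopping block of the Nambu matrix. This is the structural fact behind reading a sourced-box
  certificate in a fixed transformed-particle-number sector (FORMAT-mpsgf1 §2); the parity half is
  `Upper/PartialParticleHoleParity.lean`. (The producers' frame also carries the staggered sign `(−1)^{x+y}` on the
  `b`-modes — a further diagonal gauge unitary; the tree's `W` is the sign-free Lieb map, which already yields number
  conservation.)
-/

noncomputable section
namespace Summit.Ventures.CertifiedManyBodySolver
open Matrix Finset Literature.Probability.LatticeModels
open Literature.MathematicalPhysics.QuantumLattice Literature.Barriers.HubbardSuperconductivity HubbardWave0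
open scoped ComplexOrder ComplexConjugate

section BoxParticleHole

variable (a b : ℕ)

/-- The box pair source is a BdG bond pairing: `Σ_{(p,q)} w_C(p,q) b_{pq} = bdgPairing w_C`. [folklore] -/
theorem sum_dWaveBoxPairWeight_smul_bondPair_eq_bdgPairing :
    (∑ z : (Fin a ×ₗ Fin b) × (Fin a ×ₗ Fin b), dWaveBoxPairWeight a b z • bondPair z.1 z.2) =
      bdgPairing (fun u v : Fin a ×ₗ Fin b => dWaveBoxPairWeight a b (u, v)) := by
  rw [bdgPairing_eq, ← Fintype.sum_prod_type']
  rfl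

/-- **The open sourced box is «BdG + on-site repulsion»**: `dWaveSourceOpenBox a b U μ h =
H_BdG(τ, Δ_h, μ) + U Σ_p n_{p↑}n_{p↓}` with hopping `τ(p,q) = −[p ∼ q]` (`rectBoxGraph a b`, `t = 1`) and bond
pairing `Δ_h(p,q) = −h·w_C(p,q)`. [cite: KomaTasaki1994, §1] -/
theorem dWaveSourceOpenBox_eq_bdgBondHamiltonian_add (U μ h : ℝ) :
    dWaveSourceOpenBox a b U μ h =
      bdgBondHamiltonian (fun x y : Fin a ×ₗ Fin b => if (rectBoxGraph a b).Adj x y then -(1 : ℂ) else 0)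
        (fun u v : Fin a ×ₗ Fin b => -(h : ℂ) * dWaveBoxPairWeight a b (u, v)) μ +
        (U : ℂ) • ∑ x : Fin a ×ₗ Fin b, numberOp x 0 * numberOp x 1 := by
  have hpair : bdgPairing (fun u v : Fin a ×ₗ Fin b => -(h : ℂ) * dWaveBoxPairWeight a b (u, v)) =
      -(h : ℂ) • ∑ z : (Fin a ×ₗ Fin b) × (Fin a ×ₗ Fin b), dWaveBoxPairWeight a b z • bondPair z.1 z.2 := by
    rw [sum_dWaveBoxPairWeight_smul_bondPair_eq_bdgPairing, ← bdgPairing_smul]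
    rfl
  rw [dWaveSourceOpenBox, hamiltonianWith_eq_bdgBondHamiltonian_add, bdgBondHamiltonian_eq, bdgBondHamiltonian_eq,
    hpair]
  simp only [bdgPairing_zero, conjTranspose_zero, add_zero, neg_smul, conjTranspose_neg,
    conjTranspose_smul, Complex.star_def, Complex.conj_ofReal, smul_add, sub_eq_add_neg, neg_add, Complex.ofReal_one]
  abel

/-- **Partial particle–hole transform of the open `d`-wave–sourced Hubbard box** (all `a b`, all real `U, μ, h`):
`W · dWaveSourceOpenBox a b U μ h · Wᴴ = dΓ(𝓗) − μ·(ab)·1 + U (N_↑ − Σ_p n_{p↑}n_{p↓})` with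
`𝓗 = bdgNambuMatrix (−[p∼q]) (−h·w_C) μ` — after Lieb's transformation the sourced box CONSERVES particle number.
[cite: Lieb1989, proof of Theorem 2] -/
theorem partialParticleHole_conj_dWaveSourceOpenBox (U μ h : ℝ) :
    partialParticleHole (spinDownOrbitals : Finset (Orb (Fin a ×ₗ Fin b))) *
        dWaveSourceOpenBox a b U μ h *
        (partialParticleHole (spinDownOrbitals : Finset (Orb (Fin a ×ₗ Fin b))))ᴴ =
      dGamma (bdgNambuMatrix
          (fun x y : Fin a ×ₗ Fin b => if (rectBoxGraph a b).Adj x y then -(1 : ℂ) else 0)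
          (fun u v : Fin a ×ₗ Fin b => -(h : ℂ) * dWaveBoxPairWeight a b (u, v)) μ) -
        ((μ : ℂ) * ((a : ℂ) * (b : ℂ))) •
          (1 : Matrix (Finset (Orb (Fin a ×ₗ Fin b))) (Finset (Orb (Fin a ×ₗ Fin b))) ℂ) +
        (U : ℂ) • ((∑ x : Fin a ×ₗ Fin b, numberOp x 0) -
          ∑ x : Fin a ×ₗ Fin b, numberOp x 0 * numberOp x 1) := by
  have hcard : (Fintype.card (Fin a ×ₗ Fin b) : ℂ) = (a : ℂ) * (b : ℂ) := by
    simp [Lex, Fintype.card_prod]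
  have hdiag : (∑ x : Fin a ×ₗ Fin b,
      ((if (rectBoxGraph a b).Adj x x then -(1 : ℂ) else 0) - μ)) = -((μ : ℂ) * ((a : ℂ) * (b : ℂ))) := by
    simp only [SimpleGraph.irrefl, if_false, zero_sub, Finset.sum_neg_distrib, Finset.sum_const,
      Finset.card_univ, nsmul_eq_mul, hcard]
    ring
  have key := partialParticleHole_conj_bdgBondHamiltonian_add_onSite (Λ := Fin a ×ₗ Fin b)
    (fun x y => if (rectBoxGraph a b).Adj x y then -(1 : ℂ) else 0)
    (fun u v : Fin a ×ₗ Fin b => -(h : ℂ) * dWaveBoxPairWeight a b (u, v)) μ (U : ℂ)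
  rw [hdiag, neg_smul, ← sub_eq_add_neg] at key
  rw [dWaveSourceOpenBox_eq_bdgBondHamiltonian_add]
  convert key using 9

end BoxParticleHole
end Summit.Ventures.CertifiedManyBodySolver
end
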